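import Literature.NumberTheory.EllipticCurves.Uniformization
import HarnessLib

/-!
# Third-lattice bookkeeping: the subgroups of `⅓Λ/Λ ≅ (ℤ/3)²` (tool for the `3`-adic Γ₀/Γ₁ ledger at `9 ∣ N`)

Summit `BirchSwinnertonDyer`, route `ManinLocalTwoThree` (cell bsd-f2-manin), crux C3 `ManinPrimeToThreeAtNine`
(stmt-BirchSwinnertonDyer-22968); the `3`-adic twin of `halfLattice_trichotomy` (`…HalfLatticeVelu`, p633660).
Elementary facts about a period pair `L = (ω₁, ω₂)`, no definitions:

* `mem_or_sub_third_mem` — every `w` with `3w ∈ Λ` is congruent mod `Λ` to `0` or to `± t` for one of the four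
  third-periods `t ∈ {ω₁/3, ω₂/3, (ω₁ + ω₂)/3, (ω₁ + 2ω₂)/3}` (the four lines of `(ℤ/3)²`);
* `third_notMem` — these four third-periods are not in `Λ`;
* `thirdLattice_trichotomy` — for period lattices `Λ ⊆ Λ' ⊆ ⅓Λ`: `Λ' = Λ`, or `Λ' = ⅓Λ` (every `h` with `3h ∈ Λ`
  lies in `Λ'`), or `Λ'` has index `3` over `Λ` with an explicit third-period `z₀`: `Λ' ⊆ Λ ∪ (z₀ + Λ) ∪ (−z₀ + Λ)`.

Nothing about BSD or the Manin constant is asserted here.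
-/

set_option autoImplicit false
-- the summit-side namespace `Summit.BirchSwinnertonDyer.BirchSwinnertonDyer.…` is the tree's (summit = sub-problem)
set_option linter.dupNamespace false

noncomputable section

namespace Summit.BirchSwinnertonDyer.BirchSwinnertonDyer.Theorems.ManinLocalTwoThree

/-! ### Third-periods -/

/-- Every `w` with `3w ∈ Λ` is congruent mod `Λ` to `0` or to `±ω₁/3`, `±ω₂/3`, `±(ω₁ + ω₂)/3`, `±(ω₁ + 2ω₂)/3`. -/
theorem mem_or_sub_third_mem (L : PeriodPair) {w : ℂ} (h3 : 3 * w ∈ L.lattice) :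
    w ∈ L.lattice ∨ (w - L.ω₁ / 3 ∈ L.lattice ∨ w + L.ω₁ / 3 ∈ L.lattice) ∨
      (w - L.ω₂ / 3 ∈ L.lattice ∨ w + L.ω₂ / 3 ∈ L.lattice) ∨
      (w - (L.ω₁ + L.ω₂) / 3 ∈ L.lattice ∨ w + (L.ω₁ + L.ω₂) / 3 ∈ L.lattice) ∨
      (w - (L.ω₁ + 2 * L.ω₂) / 3 ∈ L.lattice ∨ w + (L.ω₁ + 2 * L.ω₂) / 3 ∈ L.lattice) := by
  obtain ⟨m, n, hmn⟩ := PeriodPair.mem_lattice.mp h3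
  have hw : w = (m : ℂ) / 3 * L.ω₁ + (n : ℂ) / 3 * L.ω₂ := by linear_combination -hmn / 3
  obtain ⟨m', hm⟩ : ∃ m' : ℤ, m = 3 * m' ∨ m = 3 * m' + 1 ∨ m = 3 * m' + 2 := ⟨m / 3, by omega⟩
  obtain ⟨n', hn⟩ : ∃ n' : ℤ, n = 3 * n' ∨ n = 3 * n' + 1 ∨ n = 3 * n' + 2 := ⟨n / 3, by omega⟩
  rcases hm with hm | hm | hm <;> rcases hn with hn | hn | hn
  · left
    refine PeriodPair.mem_lattice.mpr ⟨m', n', ?_⟩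
    rw [hw, hm, hn]; push_cast; ring
  · right; right; left; left
    refine PeriodPair.mem_lattice.mpr ⟨m', n', ?_⟩
    rw [hw, hm, hn]; push_cast; ring
  · right; right; left; right
    refine PeriodPair.mem_lattice.mpr ⟨m', n' + 1, ?_⟩
    rw [hw, hm, hn]; push_cast; ring
  · right; left; left
    refine PeriodPair.mem_lattice.mpr ⟨m', n', ?_⟩
    rw [hw, hm, hn]; push_cast; ring
  · right; right; right; left; left
    refine PeriodPair.mem_lattice.mpr ⟨m', n', ?_⟩
    rw [hw, hm, hn]; push_cast; ring
  · right; right; right; right; left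
    refine PeriodPair.mem_lattice.mpr ⟨m', n', ?_⟩
    rw [hw, hm, hn]; push_cast; ring
  · right; left; right
    refine PeriodPair.mem_lattice.mpr ⟨m' + 1, n', ?_⟩
    rw [hw, hm, hn]; push_cast; ring
  · right; right; right; right; right
    refine PeriodPair.mem_lattice.mpr ⟨m' + 1, n' + 1, ?_⟩
    rw [hw, hm, hn]; push_cast; ring
  · right; right; right; left; right
    refine PeriodPair.mem_lattice.mpr ⟨m' + 1, n' + 1, ?_⟩
    rw [hw, hm, hn]; push_cast; ring

/-- The four third-periods `ω₁/3, ω₂/3, (ω₁ + ω₂)/3, (ω₁ + 2ω₂)/3` are not in `Λ`. -/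
theorem third_notMem (L : PeriodPair) :
    L.ω₁ / 3 ∉ L.lattice ∧ L.ω₂ / 3 ∉ L.lattice ∧ (L.ω₁ + L.ω₂) / 3 ∉ L.lattice ∧
      (L.ω₁ + 2 * L.ω₂) / 3 ∉ L.lattice := by
  have key : ∀ α β : ℚ, ¬ (α.den = 1 ∧ β.den = 1) → (α : ℂ) * L.ω₁ + (β : ℂ) * L.ω₂ ∉ L.lattice :=
    fun α β h hmem ↦ h (PeriodPair.mul_ω₁_add_mul_ω₂_mem_lattice.mp hmem)
  refine ⟨?_, ?_, ?_, ?_⟩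
  · have h := key (1 / 3) 0 (by norm_num); intro hm; apply h; convert hm using 1; push_cast; ring
  · have h := key 0 (1 / 3) (by norm_num); intro hm; apply h; convert hm using 1; push_cast; ring
  · have h := key (1 / 3) (1 / 3) (by norm_num); intro hm; apply h; convert hm using 1; push_cast; ring
  · have h := key (1 / 3) (2 / 3) (by norm_num); intro hm; apply h; convert hm using 1; push_cast; ring

/-! ### Third-lattice trichotomy -/

/-- **Third-lattice trichotomy.**  Let `Λ ⊆ Λ'` be period lattices with `3Λ' ⊆ Λ`.  Then `Λ' = Λ`, or `Λ' ⊇ ⅓Λ` (every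
`h` with `3h ∈ Λ` lies in `Λ'`), or `Λ'` has index `3` over `Λ`: some `z₀ ∈ Λ' ∖ Λ` with `Λ' ⊆ Λ ∪ (z₀ + Λ) ∪ (−z₀ + Λ)`.
(The three kinds of subgroups of `⅓Λ/Λ ≅ (ℤ/3)²`: `0`, one of the four lines, everything — two distinct lines span.) -/
theorem thirdLattice_trichotomy (L L' : PeriodPair) (hle : L.lattice ≤ L'.lattice)
    (h3 : ∀ w ∈ L'.lattice, 3 * w ∈ L.lattice) :
    (∀ w ∈ L'.lattice, w ∈ L.lattice) ∨ (∀ h : ℂ, 3 * h ∈ L.lattice → h ∈ L'.lattice) ∨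
      ∃ z₀ ∈ L'.lattice, z₀ ∉ L.lattice ∧
        ∀ w ∈ L'.lattice, w ∈ L.lattice ∨ w - z₀ ∈ L.lattice ∨ w + z₀ ∈ L.lattice := by
  obtain ⟨n1, n2, n3, n4⟩ := third_notMem L
  set t₁ := L.ω₁ / 3 with ht₁
  set t₂ := L.ω₂ / 3 with ht₂
  set t₃ := (L.ω₁ + L.ω₂) / 3 with ht₃
  set t₄ := (L.ω₁ + 2 * L.ω₂) / 3 with ht₄
  -- from `w ∈ Λ'` and `w ∓ t ∈ Λ` recover `t ∈ Λ'`
  have backm : ∀ {w t : ℂ}, w ∈ L'.lattice → w - t ∈ L.lattice → t ∈ L'.lattice := by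
    intro w t hw hwt
    have : t = w - (w - t) := by ring
    rw [this]; exact sub_mem hw (hle hwt)
  have backp : ∀ {w t : ℂ}, w ∈ L'.lattice → w + t ∈ L.lattice → t ∈ L'.lattice := by
    intro w t hw hwt
    have : t = (w + t) - w := by ring
    rw [this]; exact sub_mem (hle hwt) hw
  -- `t₁, t₂ ∈ Λ'` generate `⅓Λ`
  have gen : t₁ ∈ L'.lattice → t₂ ∈ L'.lattice → ∀ h : ℂ, 3 * h ∈ L.lattice → h ∈ L'.lattice := by
    intro b1 b2 h hh
    obtain ⟨m, n, hmn⟩ := PeriodPair.mem_lattice.mp hh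
    have e : h = (m : ℤ) • t₁ + (n : ℤ) • t₂ := by
      rw [zsmul_eq_mul, zsmul_eq_mul, ht₁, ht₂]; linear_combination -hmn / 3
    rw [e]
    exact add_mem (L'.lattice.smul_mem m b1) (L'.lattice.smul_mem n b2)
  by_cases b1 : t₁ ∈ L'.lattice
  · by_cases b2 : t₂ ∈ L'.lattice
    · exact Or.inr (Or.inl (gen b1 b2))
    · have b3 : t₃ ∉ L'.lattice := fun b3 ↦ b2 (by
        have e : t₂ = t₃ - t₁ := by rw [ht₁, ht₂, ht₃]; ring
        rw [e]; exact sub_mem b3 b1)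
      have b4 : t₄ ∉ L'.lattice := fun b4 ↦ b2 (by
        have e : t₂ = L.ω₂ - (t₄ - t₁) := by rw [ht₁, ht₂, ht₄]; ring
        rw [e]; exact sub_mem (hle L.ω₂_mem_lattice) (sub_mem b4 b1))
      -- exactly the line of `t₁`
      right; right
      refine ⟨t₁, b1, n1, fun w hw ↦ ?_⟩
      rcases mem_or_sub_third_mem L (h3 w hw) with h0 | (h0 | h0) | (h0 | h0) | (h0 | h0) | (h0 | h0)
      · exact Or.inl h0
      · exact Or.inr (Or.inl h0)
      · exact Or.inr (Or.inr h0)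
      · exact absurd (backm hw h0) b2
      · exact absurd (backp hw h0) b2
      · exact absurd (backm hw h0) b3
      · exact absurd (backp hw h0) b3
      · exact absurd (backm hw h0) b4
      · exact absurd (backp hw h0) b4
  · by_cases b2 : t₂ ∈ L'.lattice
    · have b3 : t₃ ∉ L'.lattice := fun b3 ↦ b1 (by
        have e : t₁ = t₃ - t₂ := by rw [ht₁, ht₂, ht₃]; ring
        rw [e]; exact sub_mem b3 b2)
      have b4 : t₄ ∉ L'.lattice := fun b4 ↦ b1 (by
        have e : t₁ = t₄ - t₂ - t₂ := by rw [ht₁, ht₂, ht₄]; ring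
        rw [e]; exact sub_mem (sub_mem b4 b2) b2)
      -- exactly the line of `t₂`
      right; right
      refine ⟨t₂, b2, n2, fun w hw ↦ ?_⟩
      rcases mem_or_sub_third_mem L (h3 w hw) with h0 | (h0 | h0) | (h0 | h0) | (h0 | h0) | (h0 | h0)
      · exact Or.inl h0
      · exact absurd (backm hw h0) b1
      · exact absurd (backp hw h0) b1
      · exact Or.inr (Or.inl h0)
      · exact Or.inr (Or.inr h0)
      · exact absurd (backm hw h0) b3
      · exact absurd (backp hw h0) b3
      · exact absurd (backm hw h0) b4
      · exact absurd (backp hw h0) b4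
    · by_cases b3 : t₃ ∈ L'.lattice
      · have b4 : t₄ ∉ L'.lattice := fun b4 ↦ b2 (by
          have e : t₂ = t₄ - t₃ := by rw [ht₂, ht₃, ht₄]; ring
          rw [e]; exact sub_mem b4 b3)
        -- exactly the line of `t₃`
        right; right
        refine ⟨t₃, b3, n3, fun w hw ↦ ?_⟩
        rcases mem_or_sub_third_mem L (h3 w hw) with h0 | (h0 | h0) | (h0 | h0) | (h0 | h0) | (h0 | h0)
        · exact Or.inl h0
        · exact absurd (backm hw h0) b1
        · exact absurd (backp hw h0) b1
        · exact absurd (backm hw h0) b2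
        · exact absurd (backp hw h0) b2
        · exact Or.inr (Or.inl h0)
        · exact Or.inr (Or.inr h0)
        · exact absurd (backm hw h0) b4
        · exact absurd (backp hw h0) b4
      · by_cases b4 : t₄ ∈ L'.lattice
        · -- exactly the line of `t₄`
          right; right
          refine ⟨t₄, b4, n4, fun w hw ↦ ?_⟩
          rcases mem_or_sub_third_mem L (h3 w hw) with h0 | (h0 | h0) | (h0 | h0) | (h0 | h0) | (h0 | h0)
          · exact Or.inl h0
          · exact absurd (backm hw h0) b1
          · exact absurd (backp hw h0) b1
          · exact absurd (backm hw h0) b2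
          · exact absurd (backp hw h0) b2
          · exact absurd (backm hw h0) b3
          · exact absurd (backp hw h0) b3
          · exact Or.inr (Or.inl h0)
          · exact Or.inr (Or.inr h0)
        · -- no third-period in `Λ'`: `Λ' = Λ`
          left
          intro w hw
          rcases mem_or_sub_third_mem L (h3 w hw) with h0 | (h0 | h0) | (h0 | h0) | (h0 | h0) | (h0 | h0)
          · exact h0
          · exact absurd (backm hw h0) b1
          · exact absurd (backp hw h0) b1
          · exact absurd (backm hw h0) b2
          · exact absurd (backp hw h0) b2
          · exact absurd (backm hw h0) b3
          · exact absurd (backp hw h0) b3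
          · exact absurd (backm hw h0) b4
          · exact absurd (backp hw h0) b4

end Summit.BirchSwinnertonDyer.BirchSwinnertonDyer.Theorems.ManinLocalTwoThree

end
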